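import Summits.BirchSwinnertonDyer.Rank1Residual.ManinAdditive.KummerDiamondReciprocity
import Summits.BirchSwinnertonDyer.Rank1Residual.ManinAdditive.KummerDiamondCuspRationality
import Mathlib.NumberTheory.Cyclotomic.Gal
import HarnessLib
import HarnessLib.Audit.Tags

/-!
# THEOREM K inside `ℚ(ζ_N)`: the cyclotomic-subfield form K♭ (on Stevens' curve and on the `X₀(N)`-optimal curve in the
# index-4 world), the implication T-es-75♭ ⟹ T-es-75, and the Galois plumbing STEP 2 needs
# — cell `bsd-f2-manin`, seat `-es` g39, MEMO-es §60.7 (LEAD line `kummer_diamond`, stubs D5/D6)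

The landed THEOREM K (`…ManinAdditive.KummerDiamondReciprocity`, T-es-77, p760288) is typed over `σ : ℂ ≃ₐ[ℚ] ℂ` (the
formalism of T-es-75 `optimalGamma1Parametrization_cuspInv_galoisAction`).  STEP 2 of MEMO-es §59.5 (LEAD stub D6) must
evaluate the Kummer cocycle of the half point `S = R_Q/2` at EVERY element of `Gal(ℚ(ζ_N)/ℚ)` and test square classes by
Galois-fixedness; in the `Aut_ℚ(ℂ)` currency that needs automorphism extension (now LEAD's theorem
`ComplexAut.exists_complex_algEquiv_extends`, p760737), in the currency of the landed cyclotomic form T-es-75♭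
`optimalGamma1Parametrization_cuspInv_cyclotomic_galois` (p760743; Stevens 1982 Thm. 1.3.1 (a)(b) at `[1;y]` for
`σ ∈ Aut_ℚ ℚ(ζ_N)`, `ℚ(ζ_N) = cyclotomicSubfield N ⊂ ℂ`) it is finite Galois theory.  This file supplies the latter:

* §1 `uniformize_modularSymbol_inv_mul_eq` — the DIAMOND SHIFT `φ₁(1/(d′y)) = φ₁(1/y) + π₁(c₁{∞,γ∞}_f)` for every
  `γ ∈ Γ₀(N)` of class `(d′ mod Q, 1 mod y)` (transport lemma + Manin relation + class lemma of T-es-77; no Galois input);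
* §2 `kummerDiamondReciprocity_cyclotomic` — **K♭ on Stevens' curve**: T-es-75♭ ⟹ `φ₁(1/y)` is the base change of
  `P ∈ W₁(ℚ(ζ_N))` and `σ(P) ↦ φ₁(1/y) + π₁(c₁{∞,γ∞}_f)` for every `σ` of class `d`, `dd′ ≡ 1 (N)`, `γ` of class
  `(d′ mod Q, 1 mod y)`: `Gal(ℚ(ζ_N)/ℚ)` acts through the diamond character;
* §3 `uniformize_transfer_some`, `exists_baseChange_transfer_of_lattice_eq` — transfer of `F`-points (`F ⊂ ℂ` any
  intermediate field) along EQUAL Néron lattices by the rational coordinate change `x₀ = x₁ + (b₂¹ − b₂⁰)/12`,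
  `2y₀ + a₁⁰x₀ + a₃⁰ = ε(2y₁ + a₁¹x₁ + a₃¹)`, `ε = ±1`, commuting with `Aut_ℚ F` (the algebraic twin of T-es-77's analytic
  `map_uniformize_transfer_of_lattice_eq`), and **K♭ in the index-4 world on `W₀`**
  `indexFour_kummerDiamondReciprocity_cyclotomic`: T-es-75♭ ∧ CES ⟹ the half `S` of `R_Q` is `ℚ(ζ_N)`-rational and
  `σ(S) = S + π₀(c₀{∞,γ∞}_f/2)` for every `σ ∈ Aut_ℚ ℚ(ζ_N)` of class `d` and `γ` of class `(d′ mod Q, 1 mod y)`;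
* §4 `cuspInv_galoisAction_of_cyclotomic_galois` — **T-es-75♭ ⟹ T-es-75** (restrict `σ ∈ Aut_ℚ(ℂ)` to the normal
  subfield `ℚ(ζ_N)`): the two named Stevens facts are ONE Literature debt;
* §5 `exists_aut_cyclotomicSubfield_zetaGen_eq_pow` (GALOIS SUPPLY: for every `d` coprime to `N` an automorphism with
  `σ(ζ_N) = ζ_N^d`), `exists_ratCast_eq_of_forall_aut_cyclotomicSubfield_fixed` (RATIONALITY TEST: fixed by all `σ` ⟹
  rational) and its converse — the plumbing D6-use consumes in the ♭ currency.

HONEST FRAMING: everything here is a THEOREM modulo the named printed fact T-es-75♭ (statement-only, landed) and, for the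
index-4 form, CES `exists_optimal_gamma1ParametrizationData`; E-es-185 `IndexFourForcesFreyTwistShape`, C2
`ManinOddAtFour`, Manin's conjecture and BSD are NOT proved here.  Theorem-only file: no `def`, no instance, no sorry.

TYPER NOTE (typer g21, T-es-79, part 1 of 2).  SOURCE = HOME/es/g39/KummerDiamondCyclotomic-es-g39.lean sha16 94a97726191eac3d (474 l.; es: farm
rc 0·0·0·0, std axioms; MEMO-es §60.7) VERBATIM, SPLIT at a section boundary because theorem-bearing files are capped at 400 lines
(`lint.statement-form`): THIS file = header + §1 (diamond shift identity) + §2 (K♭ on Stevens' curve) + §3 (transfer of `F`-points, K♭ in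
the index-4 world on `W₀`), ll. 1–364 of the source; the sibling `KummerDiamondCyclotomicSupply.lean` (imports this file) = §4 helpers + §5
(Galois supply / rationality test in `ℚ(ζ_N)`).  The source's §4 theorem `cuspInv_galoisAction_of_cyclotomic_galois : T-es-75♭ → T-es-75` is
NOT landed here: the SAME lemma (ref1 §R222) already lives in the tree as the Literature theorem
`Literature.NumberTheory.EllipticCurves.ModularForms.optimalGamma1Parametrization_cuspInv_galoisAction_of_cyclotomic`
(`Gamma1ParametrizationCuspGaloisActionProofs.lean`, p761747) — es 05:02Z: «the SAME lemma — land one»; an identical restatement would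
bounce `dedup.landed`.  Cone side (imports the landed cone-side `KummerDiamondReciprocity` / `KummerDiamondCuspRationality`); theorem-only
(kind proof), no def, no instance; no tree declaration bore these names/statements at landing (rg 05:0xZ; the tree's
`…KatoDescentKatoRigidAugValues.isCoprime_of_mul_modEq_one` concludes `IsCoprime d A`, a different statement).  HONEST FRAMING as es states
it: theorems MODULO the named printed fact T-es-75♭ (and CES for the index-4 form); E-es-185, C2, Manin c = 1, BSD NOT proved; C2/C3 OPEN.
bears_on: stmt-BirchSwinnertonDyer-22967.
-/

set_option autoImplicit false

noncomputable section

open scoped Classical MatrixGroups ModularForm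

open CongruenceSubgroup Complex WeierstrassCurve Literature.NumberTheory.EllipticCurves
  Literature.NumberTheory.EllipticCurves.ModularForms
open Summit.BirchSwinnertonDyer.BirchSwinnertonDyer.Theorems.ManinLocalTwoThree

namespace Summit.BirchSwinnertonDyer.Rank1Residual.ManinAdditive.KummerDiamond

/-! ### §1. The diamond shift identity on an `X₁(N)`-datum (no Galois input) -/

section Shift

variable {W : WeierstrassCurve ℚ} {N : ℕ} [NeZero N]

/-- **Diamond shift.** For any `X₁(N)`-datum `D`, `N = Q·y` with `gcd(Q,y) = 1`, `d′ ≠ 0` coprime to `N`, and any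
`γ ∈ Γ₀(N)` with `d_γ ≡ d′ (mod Q)`, `d_γ ≡ 1 (mod y)`:  `φ₁(1/(d′y)) = φ₁(1/y) + π₁(c₁·{∞,γ∞}_f)`.
(Transport `γ₀·(1/y) = 1/(d′y)` + Manin's relation + `{∞,γ∞} − {∞,γ₀∞} ∈ Λ₁(f)` for `d_γ ≡ d_{γ₀} (mod N)`.) [folklore] -/
theorem uniformize_modularSymbol_inv_mul_eq (D : Gamma1ParametrizationData W N) (d' : ℤ)
    (hd'cop : IsCoprime d' (N : ℤ)) (hd'0 : d' ≠ 0) (Q y : ℕ) (hQy : Q * y = N) (hcop : Nat.Coprime Q y)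
    (γ : Gamma0 N) (hγQ : (((γ : SL(2, ℤ)) 1 1 : ℤ) : ZMod Q) = (d' : ZMod Q))
    (hγy : (((γ : SL(2, ℤ)) 1 1 : ℤ) : ZMod y) = 1) :
    D.uniformize ((D.c : ℂ) * modularSymbol D.f (1 / ((d' : ℚ) * y))) =
      D.uniformize ((D.c : ℂ) * modularSymbol D.f (1 / (y : ℚ))) + D.uniformize ((D.c : ℂ) * cuspSymbol D.f γ) := by
  obtain ⟨γ₀, hγ₀Q, hγ₀y, hnum, hden⟩ := exists_gamma0_cusp_transport Q y hQy hcop d' hd'cop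
  have hr : ((γ₀ : SL(2, ℤ)) 1 0 : ℚ) * (1 / (y : ℚ)) + ((γ₀ : SL(2, ℤ)) 1 1 : ℚ) ≠ 0 := by
    rw [hden]; exact_mod_cast hd'0
  have hManin := modularSymbol_gamma0_smul_holds D.f γ₀ (1 / (y : ℚ)) hr
  rw [hnum, hden, show (1 / (y : ℚ)) / (d' : ℚ) = 1 / ((d' : ℚ) * y) by rw [div_div, mul_comm]] at hManin
  rw [hManin, mul_add, map_add, add_comm, uniformize_cuspSymbol_eq_of_apply_eq D γ₀ γ]
  exact intCast_zmod_eq_of_eq_mod_coprime hQy hcop (hγ₀Q.trans hγQ.symm) (hγ₀y.trans hγy.symm)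

omit [NeZero N] in
/-- `d·d′ ≡ 1 (mod N)` with `d′ = 0` forces `N = 1`. [folklore] -/
theorem eq_one_of_mul_zero_modEq_one {d : ℤ} (h : d * 0 ≡ 1 [ZMOD N]) : N = 1 := by
  rw [mul_zero] at h
  obtain ⟨m, hm⟩ := h.dvd
  have h1 : (N : ℤ) ∣ 1 := ⟨m, by linear_combination hm⟩
  exact_mod_cast Int.eq_one_of_dvd_one (by positivity) h1

omit [NeZero N] in
/-- `d·d′ ≡ 1 (mod N)` makes `d′` coprime to `N`. [folklore] -/
theorem isCoprime_of_mul_modEq_one {d d' : ℤ} (h : d * d' ≡ 1 [ZMOD N]) : IsCoprime d' (N : ℤ) := by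
  obtain ⟨m, hm⟩ := h.dvd
  exact ⟨d, m, by linear_combination -hm⟩

end Shift

/-! ### §2. K♭ on Stevens' curve: the Galois group of `ℚ(ζ_N)` acts on `φ₁(1/y)` through the diamond character -/

section StevensCurveFlat

variable {N : ℕ} [NeZero N]

/-- **THEOREM K♭ (cyclotomic-subfield form of K♮; THEOREM modulo T-es-75♭).**  On Stevens' curve `W` with its optimal
`X₁(N)`-datum, for `N = Q·y`, `gcd(Q,y) = 1`: the cusp value `φ₁(1/y)` is the base change of a point `P ∈ W(ℚ(ζ_N))`, and
every `σ ∈ Aut_ℚ ℚ(ζ_N)` with `σ(ζ_N) = ζ_N^d`, `dd′ ≡ 1 (mod N)`, maps `P` to the point over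
`φ₁(1/y) + π₁(c₁·{∞,γ∞}_f)` for any `γ ∈ Γ₀(N)` with `d_γ ≡ d′ (mod Q)`, `d_γ ≡ 1 (mod y)` — the Kummer–diamond
reciprocity seen by `Gal(ℚ(ζ_N)/ℚ)` itself. [cite: Stevens1982, Thm. 1.3.1 (a)(b)] [cite: Manin1972, Thm. 1.6] -/
theorem kummerDiamondReciprocity_cyclotomic (hSt : optimalGamma1Parametrization_cuspInv_cyclotomic_galois)
    (W : WeierstrassCurve ℚ) [W.IsElliptic] (D : Gamma1ParametrizationData W N) (hD : D.IsOptimal)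
    (Q y : ℕ) (hQy : Q * y = N) (hcop : Nat.Coprime Q y) :
    ∃ P : (W.baseChange (cyclotomicSubfield N)).toAffine.Point,
      Affine.Point.baseChange (W' := W) (cyclotomicSubfield N) ℂ P =
          D.uniformize ((D.c : ℂ) * modularSymbol D.f (1 / (y : ℚ))) ∧
      ∀ (d : ℕ) (d' : ℤ), (d : ℤ) * d' ≡ 1 [ZMOD N] →
      ∀ σ : cyclotomicSubfield N ≃ₐ[ℚ] cyclotomicSubfield N, (σ (zetaGen N) : ℂ) = rootOfUnityExp N ^ d →
      ∀ γ : Gamma0 N, (((γ : SL(2, ℤ)) 1 1 : ℤ) : ZMod Q) = (d' : ZMod Q) →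
        (((γ : SL(2, ℤ)) 1 1 : ℤ) : ZMod y) = 1 →
        Affine.Point.baseChange (W' := W) (cyclotomicSubfield N) ℂ
            (Affine.Point.map (W' := W) (σ : cyclotomicSubfield N →ₐ[ℚ] cyclotomicSubfield N) P) =
          D.uniformize ((D.c : ℂ) * modularSymbol D.f (1 / (y : ℚ))) +
            D.uniformize ((D.c : ℂ) * cuspSymbol D.f γ) := by
  have hN0 : N ≠ 0 := NeZero.ne N
  have hy0 : y ≠ 0 := by rintro rfl; exact hN0 (by rw [← hQy, mul_zero])
  have hyZ : (y : ℤ) ≠ 0 := by exact_mod_cast hy0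
  obtain ⟨P, hP, hGal⟩ := hSt W D hD (y : ℤ) hyZ
  rw [Int.cast_natCast] at hP
  refine ⟨P, hP, ?_⟩
  intro d d' hdd' σ hσ γ hγQ hγy
  by_cases hd'0 : d' = 0
  · subst hd'0
    have hN1 : N = 1 := eq_one_of_mul_zero_modEq_one hdd'
    subst hN1
    have h1 := hGal d 1 Int.modEq_one σ hσ
    rw [Int.cast_one, one_mul, Int.cast_natCast] at h1
    rw [h1, left_eq_add, gamma1_uniformize_eq_zero_iff]
    exact D.smul_periodLatticeGamma1_le _
      (cuspSymbol_mem_periodLatticeGamma1_of_apply_eq_one D.f γ (Subsingleton.elim _ _))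
  · have h1 := hGal d d' hdd' σ hσ
    rw [Int.cast_natCast] at h1
    rw [h1]
    exact uniformize_modularSymbol_inv_mul_eq D d' (isCoprime_of_mul_modEq_one hdd') hd'0 Q y hQy hcop γ hγQ hγy

end StevensCurveFlat

/-! ### §3. Transfer of `F`-points along equal Néron lattices; K♭ in the index-4 world on `W₀` -/

section TransferFlat

variable {W₁ W₀ : WeierstrassCurve ℚ} {N : ℕ} [NeZero N]

/-- The `℘`-coordinates of the two uniformisations along equal Néron lattices (`ε = ±1`): if `π₁(z) = (x₁, y₁)` then
`π₀(εz) = (x₁ + (b₂¹ − b₂⁰)/12, (ε(2y₁ + a₁¹x₁ + a₃¹) − a₁⁰x₀ − a₃⁰)/2)`. [folklore] -/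
theorem uniformize_transfer_some (D₁ : Gamma1ParametrizationData W₁ N) (D₀ : ModularParametrizationData W₀ N)
    (hΛ : D₀.L.lattice = D₁.L.lattice) {ε : ℤ} (hε : ε = 1 ∨ ε = -1) {z x₁ y₁ : ℂ}
    {h₁ : (W₁.baseChange ℂ).toAffine.Nonsingular x₁ y₁} (h : D₁.uniformize z = .some x₁ y₁ h₁) :
    ∃ h₀, D₀.uniformize ((ε : ℂ) * z) =
      .some (x₁ + (((W₁.b₂ - W₀.b₂) / 12 : ℚ) : ℂ))
        (((ε : ℂ) * (2 * y₁ + (W₁.a₁ : ℂ) * x₁ + (W₁.a₃ : ℂ)) -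
          (W₀.a₁ : ℂ) * (x₁ + (((W₁.b₂ - W₀.b₂) / 12 : ℚ) : ℂ)) - (W₀.a₃ : ℂ)) / 2) h₀ := by
  have hker₁ := gamma1_uniformize_eq_zero_iff D₁
  have hεC : (ε : ℂ) = 1 ∨ (ε : ℂ) = -1 := by
    rcases hε with rfl | rfl <;> simp
  have hεmem : ∀ w : ℂ, w ∈ D₁.L.lattice ↔ (ε : ℂ) * w ∈ D₀.L.lattice := by
    intro w
    rcases hεC with h1 | h1 <;> rw [h1]
    · rw [one_mul, hΛ]
    · rw [neg_one_mul, hΛ, neg_mem_iff]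
  have hP : ∀ w : ℂ, D₀.L.weierstrassP ((ε : ℂ) * w) = D₁.L.weierstrassP w := by
    intro w
    rw [PeriodPair.weierstrassP_eq_of_lattice_eq hΛ]
    rcases hεC with h1 | h1 <;> rw [h1]
    · rw [one_mul]
    · rw [neg_one_mul, PeriodPair.weierstrassP_neg]
  have hP' : ∀ w : ℂ, D₀.L.derivWeierstrassP ((ε : ℂ) * w) = (ε : ℂ) * D₁.L.derivWeierstrassP w := by
    intro w
    rw [PeriodPair.derivWeierstrassP_eq_of_lattice_eq hΛ]
    rcases hεC with h1 | h1 <;> rw [h1]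
    · rw [one_mul, one_mul]
    · rw [neg_one_mul, PeriodPair.derivWeierstrassP_neg, neg_one_mul]
  have hz : z ∉ D₁.L.lattice := by
    intro hz
    rw [(hker₁ z).mpr hz] at h
    exact Affine.Point.some_ne_zero _ h.symm
  obtain ⟨n₁, hspec⟩ := D₁.uniformize_spec z hz
  obtain ⟨n₀, hspec₀⟩ := D₀.uniformize_spec ((ε : ℂ) * z) (fun hm ↦ hz ((hεmem z).mpr hm))
  rw [hspec, Affine.Point.some.injEq] at h
  obtain ⟨hx, hy⟩ := h
  have hb₁ : (W₁.baseChange ℂ).b₂ = (W₁.b₂ : ℂ) := by simp [WeierstrassCurve.baseChange, WeierstrassCurve.map_b₂]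
  have hb₀ : (W₀.baseChange ℂ).b₂ = (W₀.b₂ : ℂ) := by simp [WeierstrassCurve.baseChange, WeierstrassCurve.map_b₂]
  have ha₁ : (W₁.baseChange ℂ).a₁ = (W₁.a₁ : ℂ) := by simp [WeierstrassCurve.baseChange, WeierstrassCurve.map_a₁]
  have ha₃ : (W₁.baseChange ℂ).a₃ = (W₁.a₃ : ℂ) := by simp [WeierstrassCurve.baseChange, WeierstrassCurve.map_a₃]
  have ha₁' : (W₀.baseChange ℂ).a₁ = (W₀.a₁ : ℂ) := by simp [WeierstrassCurve.baseChange, WeierstrassCurve.map_a₁]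
  have ha₃' : (W₀.baseChange ℂ).a₃ = (W₀.a₃ : ℂ) := by simp [WeierstrassCurve.baseChange, WeierstrassCurve.map_a₃]
  simp only [hb₁] at hx
  simp only [hb₁, ha₁, ha₃] at hy
  have hPz : D₁.L.weierstrassP z = x₁ + (W₁.b₂ : ℂ) / 12 := by linear_combination hx
  have hP'z : D₁.L.derivWeierstrassP z = 2 * y₁ + (W₁.a₁ : ℂ) * x₁ + (W₁.a₃ : ℂ) := by
    rw [hx] at hy; linear_combination 2 * hy
  have hx₀ : D₀.L.weierstrassP ((ε : ℂ) * z) - (W₀.baseChange ℂ).b₂ / 12 =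
      x₁ + (((W₁.b₂ - W₀.b₂) / 12 : ℚ) : ℂ) := by
    rw [hP z, hPz, hb₀]; push_cast; ring
  have hy₀ : (D₀.L.derivWeierstrassP ((ε : ℂ) * z) -
        (W₀.baseChange ℂ).a₁ * (x₁ + (((W₁.b₂ - W₀.b₂) / 12 : ℚ) : ℂ)) - (W₀.baseChange ℂ).a₃) / 2 =
      ((ε : ℂ) * (2 * y₁ + (W₁.a₁ : ℂ) * x₁ + (W₁.a₃ : ℂ)) -
        (W₀.a₁ : ℂ) * (x₁ + (((W₁.b₂ - W₀.b₂) / 12 : ℚ) : ℂ)) - (W₀.a₃ : ℂ)) / 2 := by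
    rw [hP' z, hP'z, ha₁', ha₃']
  have hy₀full : (D₀.L.derivWeierstrassP ((ε : ℂ) * z) -
        (W₀.baseChange ℂ).a₁ * (D₀.L.weierstrassP ((ε : ℂ) * z) - (W₀.baseChange ℂ).b₂ / 12) -
        (W₀.baseChange ℂ).a₃) / 2 =
      ((ε : ℂ) * (2 * y₁ + (W₁.a₁ : ℂ) * x₁ + (W₁.a₃ : ℂ)) -
        (W₀.a₁ : ℂ) * (x₁ + (((W₁.b₂ - W₀.b₂) / 12 : ℚ) : ℂ)) - (W₀.a₃ : ℂ)) / 2 := by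
    rw [hx₀]; exact hy₀
  have n₀' := n₀
  rw [hy₀full, hx₀] at n₀'
  refine ⟨n₀', ?_⟩
  rw [hspec₀, Affine.Point.some.injEq]
  exact ⟨hx₀, hy₀full⟩

/-- **Transfer of `F`-points along equal Néron lattices.**  If the `X₁(N)`-datum `D₁` of `W₁` and the `X₀(N)`-datum `D₀`
of `W₀` have the same Néron lattice and `P₁ ∈ W₁(F)` (`F ⊆ ℂ` an intermediate field) lies over `π₁(z)`, then the rational
coordinate change produces `P₀ ∈ W₀(F)` over `π₀(εz)` such that, for every `σ ∈ Aut_ℚ F`, `σ(P₁)` over `π₁(z′)` implies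
`σ(P₀)` over `π₀(εz′)`. [folklore] -/
theorem exists_baseChange_transfer_of_lattice_eq (F : IntermediateField ℚ ℂ)
    (D₁ : Gamma1ParametrizationData W₁ N) (D₀ : ModularParametrizationData W₀ N)
    (hΛ : D₀.L.lattice = D₁.L.lattice) {ε : ℤ} (hε : ε = 1 ∨ ε = -1)
    (P₁ : (W₁.baseChange F).toAffine.Point) {z : ℂ}
    (hP₁ : Affine.Point.baseChange (W' := W₁) F ℂ P₁ = D₁.uniformize z) :
    ∃ P₀ : (W₀.baseChange F).toAffine.Point,
      Affine.Point.baseChange (W' := W₀) F ℂ P₀ = D₀.uniformize ((ε : ℂ) * z) ∧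
      ∀ (σ : F ≃ₐ[ℚ] F) (z' : ℂ),
        Affine.Point.baseChange (W' := W₁) F ℂ (Affine.Point.map (W' := W₁) (σ : F →ₐ[ℚ] F) P₁) =
            D₁.uniformize z' →
        Affine.Point.baseChange (W' := W₀) F ℂ (Affine.Point.map (W' := W₀) (σ : F →ₐ[ℚ] F) P₀) =
            D₀.uniformize ((ε : ℂ) * z') := by
  have hker₁ := gamma1_uniformize_eq_zero_iff D₁
  have hker₀ := D₀.uniformize_eq_zero_iff
  have hεC : (ε : ℂ) = 1 ∨ (ε : ℂ) = -1 := by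
    rcases hε with rfl | rfl <;> simp
  have hεmem : ∀ w : ℂ, w ∈ D₁.L.lattice ↔ (ε : ℂ) * w ∈ D₀.L.lattice := by
    intro w
    rcases hεC with h1 | h1 <;> rw [h1]
    · rw [one_mul, hΛ]
    · rw [neg_one_mul, hΛ, neg_mem_iff]
  -- casts: `ℚ`-constants of `F` go to the same constants of `ℂ`
  have hcastF : ∀ q : ℚ, algebraMap F ℂ (algebraMap ℚ F q) = (q : ℂ) := by
    intro q
    rw [← IsScalarTower.algebraMap_apply, eq_ratCast]
  rcases P₁ with _ | ⟨X₁, Y₁, hXY₁⟩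
  · -- `P₁ = 0`: then `z ∈ Λ`, take `P₀ = 0`
    have hz : z ∈ D₁.L.lattice := by
      rw [← hker₁ z, ← hP₁]; rfl
    refine ⟨0, ?_, ?_⟩
    · rw [map_zero, eq_comm, hker₀]; exact (hεmem z).mp hz
    · intro σ z' h
      have hz' : z' ∈ D₁.L.lattice := by
        rw [← hker₁ z', ← h]; rfl
      rw [show Affine.Point.map (W' := W₀) (σ : F →ₐ[ℚ] F) (0 : (W₀.baseChange F).toAffine.Point) = 0 from rfl,
        map_zero, eq_comm, hker₀]
      exact (hεmem z').mp hz'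
  · -- `P₁ = (X₁, Y₁)` over `F`
    set κ : ℚ := (W₁.b₂ - W₀.b₂) / 12 with hκ
    -- the transferred coordinates in `F`
    set X₀ : F := X₁ + algebraMap ℚ F κ with hX₀
    set Y₀ : F := ((algebraMap ℚ F (ε : ℚ)) * (2 * Y₁ + algebraMap ℚ F W₁.a₁ * X₁ + algebraMap ℚ F W₁.a₃) -
        algebraMap ℚ F W₀.a₁ * X₀ - algebraMap ℚ F W₀.a₃) / 2 with hY₀
    have hbc₁ : Affine.Point.baseChange (W' := W₁) F ℂ (.some X₁ Y₁ hXY₁) =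
        .some (algebraMap F ℂ X₁) (algebraMap F ℂ Y₁)
          ((W₁.toAffine.baseChange_nonsingular (Algebra.ofId F ℂ).injective ..).mpr hXY₁) := rfl
    rw [hbc₁] at hP₁
    obtain ⟨h₀, hspec₀⟩ := uniformize_transfer_some D₁ D₀ hΛ hε hP₁.symm
    have hεq : algebraMap F ℂ (algebraMap ℚ F (ε : ℚ)) = (ε : ℂ) := by rw [hcastF]; push_cast; rfl
    have hXC : algebraMap F ℂ X₀ = algebraMap F ℂ X₁ + ((κ : ℚ) : ℂ) := by
      rw [hX₀, map_add, hcastF]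
    have hYC : algebraMap F ℂ Y₀ = (((ε : ℂ) * (2 * algebraMap F ℂ Y₁ + (W₁.a₁ : ℂ) * algebraMap F ℂ X₁ +
        (W₁.a₃ : ℂ)) - (W₀.a₁ : ℂ) * (algebraMap F ℂ X₁ + ((κ : ℚ) : ℂ)) - (W₀.a₃ : ℂ)) / 2) := by
      rw [hY₀]
      simp only [map_div₀, map_sub, map_mul, map_add, map_ofNat, hεq, hcastF, hXC]
    have h₀F : (W₀.baseChange F).toAffine.Nonsingular X₀ Y₀ := by
      refine (W₀.toAffine.baseChange_nonsingular (Algebra.ofId F ℂ).injective X₀ Y₀).mp ?_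
      change (W₀.baseChange ℂ).toAffine.Nonsingular (algebraMap F ℂ X₀) (algebraMap F ℂ Y₀)
      rw [hXC, hYC]; exact h₀
    refine ⟨.some X₀ Y₀ h₀F, ?_, ?_⟩
    · rw [hspec₀]
      change Affine.Point.some (algebraMap F ℂ X₀) (algebraMap F ℂ Y₀) _ = _
      rw [Affine.Point.some.injEq]
      exact ⟨hXC, hYC⟩
    · intro σ z' hz'
      -- `σ(P₁) = (σX₁, σY₁)` over `π₁(z′)`
      have hbcσ₁ : Affine.Point.baseChange (W' := W₁) F ℂ
          (Affine.Point.map (W' := W₁) (σ : F →ₐ[ℚ] F) (.some X₁ Y₁ hXY₁)) =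
          .some (algebraMap F ℂ (σ X₁)) (algebraMap F ℂ (σ Y₁))
            ((W₁.toAffine.baseChange_nonsingular (Algebra.ofId F ℂ).injective ..).mpr
              ((W₁.toAffine.baseChange_nonsingular (σ : F →ₐ[ℚ] F).injective ..).mpr hXY₁)) := rfl
      rw [hbcσ₁] at hz'
      obtain ⟨h₀', hspec₀'⟩ := uniformize_transfer_some D₁ D₀ hΛ hε hz'.symm
      have hσX : σ X₀ = σ X₁ + algebraMap ℚ F κ := by
        rw [hX₀, map_add, AlgEquiv.commutes]
      have hσY : σ Y₀ = ((algebraMap ℚ F (ε : ℚ)) * (2 * σ Y₁ + algebraMap ℚ F W₁.a₁ * σ X₁ +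
          algebraMap ℚ F W₁.a₃) - algebraMap ℚ F W₀.a₁ * σ X₀ - algebraMap ℚ F W₀.a₃) / 2 := by
        rw [hY₀]
        simp only [map_div₀, map_sub, map_mul, map_add, AlgEquiv.commutes, map_ofNat]
      have hσXC : algebraMap F ℂ (σ X₀) = algebraMap F ℂ (σ X₁) + ((κ : ℚ) : ℂ) := by
        rw [hσX, map_add, hcastF]
      have hσYC : algebraMap F ℂ (σ Y₀) = (((ε : ℂ) * (2 * algebraMap F ℂ (σ Y₁) +
          (W₁.a₁ : ℂ) * algebraMap F ℂ (σ X₁) + (W₁.a₃ : ℂ)) -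
          (W₀.a₁ : ℂ) * (algebraMap F ℂ (σ X₁) + ((κ : ℚ) : ℂ)) - (W₀.a₃ : ℂ)) / 2) := by
        rw [hσY]
        simp only [map_div₀, map_sub, map_mul, map_add, map_ofNat, hεq, hcastF, hσXC]
      rw [hspec₀']
      change Affine.Point.some (algebraMap F ℂ (σ X₀)) (algebraMap F ℂ (σ Y₀)) _ = _
      rw [Affine.Point.some.injEq]
      exact ⟨hσXC, hσYC⟩

/-- **THEOREM K♭ in the index-`4` world on the `X₀(N)`-optimal curve (THEOREM modulo T-es-75♭ ∧ CES).**  Under the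
hypotheses of E-es-185 (`W₀` globally minimal, `D₀` lattice-optimal, `Λ₁(f) = 2Λ₀(f)`), for `N = Q·y`, `gcd(Q,y) = 1`:
the HALF `S := π₀(c₀·{∞,1/y}_f/2)` of the Atkin–Lehner cusp value `R_Q` is the base change of a point of `W₀` over
`ℚ(ζ_N)`, and every `σ ∈ Aut_ℚ ℚ(ζ_N)` with `σ(ζ_N) = ζ_N^d`, `dd′ ≡ 1 (mod N)`, maps it to the point over
`S + π₀(c₀·{∞,γ∞}_f/2)` for any `γ ∈ Γ₀(N)` with `d_γ ≡ d′ (mod Q)`, `d_γ ≡ 1 (mod y)`: the `2`-descent cocycle of `S`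
on `Gal(ℚ(ζ_N)/ℚ)` is the diamond image — STEP 2's input in finite Galois theory.
[cite: Stevens1982, Thm. 1.3.1] [cite: ConradEdixhovenStein2003, §6.1, Lemma 6.1.6] [cite: Stevens1989, §2] -/
theorem indexFour_kummerDiamondReciprocity_cyclotomic
    (hSt : optimalGamma1Parametrization_cuspInv_cyclotomic_galois) (hCES : exists_optimal_gamma1ParametrizationData)
    (W₀ : WeierstrassCurve ℚ) [W₀.IsElliptic] [W₀.IsGloballyMinimal] (D₀ : ModularParametrizationData W₀ N)
    (hopt : ∀ z ∈ D₀.L.lattice, ∃ w ∈ periodLattice D₀.f, z = D₀.c * w)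
    (h4 : ∀ z : ℂ, z ∈ periodLatticeGamma1 D₀.f ↔ ∃ w ∈ periodLattice D₀.f, z = 2 * w)
    (Q y : ℕ) (hQy : Q * y = N) (hcop : Nat.Coprime Q y) :
    ∃ S : (W₀.baseChange (cyclotomicSubfield N)).toAffine.Point,
      Affine.Point.baseChange (W' := W₀) (cyclotomicSubfield N) ℂ S =
          D₀.uniformize ((D₀.c : ℂ) * modularSymbol D₀.f (1 / (y : ℚ)) / 2) ∧
      ∀ (d : ℕ) (d' : ℤ), (d : ℤ) * d' ≡ 1 [ZMOD N] →
      ∀ σ : cyclotomicSubfield N ≃ₐ[ℚ] cyclotomicSubfield N, (σ (zetaGen N) : ℂ) = rootOfUnityExp N ^ d →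
      ∀ γ : Gamma0 N, (((γ : SL(2, ℤ)) 1 1 : ℤ) : ZMod Q) = (d' : ZMod Q) →
        (((γ : SL(2, ℤ)) 1 1 : ℤ) : ZMod y) = 1 →
        Affine.Point.baseChange (W' := W₀) (cyclotomicSubfield N) ℂ
            (Affine.Point.map (W' := W₀) (σ : cyclotomicSubfield N →ₐ[ℚ] cyclotomicSubfield N) S) =
          D₀.uniformize ((D₀.c : ℂ) * modularSymbol D₀.f (1 / (y : ℚ)) / 2) +
            D₀.uniformize ((D₀.c : ℂ) * cuspSymbol D₀.f γ / 2) := by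
  obtain ⟨W₁, _, _, D₁, hiso, hD₁⟩ := hCES W₀ D₀ hopt
  have hf : D₁.f = D₀.f := D₁.f_eq_of_isIsogenous D₀ hiso
  have hidx : ∀ z : ℂ, z ∈ periodLatticeGamma1 D₁.f ↔ ∃ w ∈ periodLattice D₀.f, z = 2 * w := by
    rw [hf]; exact h4
  have hidx' : ∀ z : ℂ, z ∈ periodLatticeGamma1 D₁.f ↔ ∃ w ∈ periodLattice D₀.f, z = ((2 : ℤ) : ℂ) * w := by
    intro z; rw [hidx z, Int.cast_ofNat]
  have hΛ : D₀.L.lattice = D₁.L.lattice := lattice_eq_of_index_four D₁ D₀ hD₁ hopt hidx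
  -- `c₀ = ε · 2c₁`, `ε = ±1`
  obtain ⟨ε, hε, hcc⟩ : ∃ ε : ℤ, (ε = 1 ∨ ε = -1) ∧ (D₀.c : ℂ) = (ε : ℂ) * (2 * D₁.c) := by
    rcases maninConstant₀_eq_mul_or_eq_neg_mul_of_periodLatticeGamma1_eq_mul D₁ D₀ hD₁ hopt 2 hidx' with h | h
    · refine ⟨1, Or.inl rfl, ?_⟩
      rw [Int.cast_one, one_mul]
      exact_mod_cast h
    · refine ⟨-1, Or.inr rfl, ?_⟩
      rw [Int.cast_neg, Int.cast_one, neg_one_mul]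
      exact_mod_cast h
  have hhalf : ∀ s : ℂ, (D₀.c : ℂ) * s / 2 = (ε : ℂ) * ((D₁.c : ℂ) * s) := by
    intro s; rw [hcc]; ring
  -- K♭ on Stevens' curve, then transfer
  obtain ⟨P₁, hP₁, hGal₁⟩ := kummerDiamondReciprocity_cyclotomic hSt W₁ D₁ hD₁ Q y hQy hcop
  obtain ⟨S, hS, hSgal⟩ :=
    exists_baseChange_transfer_of_lattice_eq (cyclotomicSubfield N) D₁ D₀ hΛ hε P₁ hP₁
  refine ⟨S, ?_, ?_⟩
  · rw [hS, hhalf, hf]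
  · intro d d' hdd' σ hσ γ hγQ hγy
    have h := hGal₁ d d' hdd' σ hσ γ hγQ hγy
    rw [hf, ← map_add] at h
    rw [hhalf, hhalf, ← map_add, ← mul_add]
    exact hSgal σ _ h

end TransferFlat

end Summit.BirchSwinnertonDyer.Rank1Residual.ManinAdditive.KummerDiamond

end
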